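import Summits.Ventures.YMGap.FlowData.TubeGaugeInvariance
import Summits.Ventures.YMGap.FlowData.TubeFluxSectors
import HarnessLib

/-!
# Venture YMGap, track Y3 FLOW-DATA — inside the axial flux sector the transfer operator only sees functions that
# are ODD UNDER EVERY HYPERPLANE FLIP along the axis (theorems only)

HONEST FRAMING: venture file of the cell `pub-ymgap` (QuantumFields programme), track Y3; companion THEOREMS for
`FlowData/TubeTransferOperator.lean` preparing the STRONG-COUPLING WINDOW for the typed torelon energy
(`FlowData/TubeStrongCouplingWindow.lean`).  Finite spatial torus `(ℤ/L)^k`, compact gauge group `G`, central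
involution `z` (`z² = 1`); no number, no row, nothing about limits or a mass gap.

For an axis `μ` and `s ∈ ℤ/L` the HYPERPLANE FLIP `σ_s` multiplies every `μ`-link `(x, μ)` with `x_μ = s` by `z`
(`σ_0 = fluxTwist z ê_μ`, `fluxTwist_single_eq_hyperplaneFlip`).  The LAYER gauge transformation
`η_t(x) = z^{[x_μ = t]}` satisfies `b^{η_t} = σ_t (σ_{t−1} b)` (`gaugeTransform_layer`): consecutive flips differ by a
gauge transformation.  Since `T ∘ G_γ = T` for every gauge transformation (`tubeTransferOperator_comp_gaugeOp`),
symmetrising a vector of the flux sector `ê_μ` over the `η_t` does not change its image under `T`: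

* **`exists_jointlyOdd_of_fluxProjection`** — for every flux `e ∈ ℤ₂^k` and `ψ ∈ L²(slice)` there is `g ∈ L²(slice)`
  with `T g = T (P_e ψ)`, `‖g‖ ≤ ‖ψ‖`, and `g ∘ σ_{μ,s} = −g` a.e. for EVERY direction `μ` with `e_μ = 1` and EVERY
  `s ∈ ℤ/L` (`exists_jointlyOdd_of_fluxProjection_single`: the axial case `e = ê_μ`).

This is the Gauss-law input of the strong-coupling window: a `z`-odd gauge-invariant wave function carries its
centre flux through every hyperplane transverse to the axis, not only through the twisted one.
References: G. 't Hooft, Nucl. Phys. B 153 (1979) 141 [cite: tHooft1979Flux]; M. Lüscher, Commun. Math. Phys. 54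
(1977) 283 [cite: Luscher1977]; I. Montvay, G. Münster (1994) §3.2.6 [cite: MontvayMunster1994, §3.2.6].
-/

noncomputable section

open scoped BigOperators
open MeasureTheory Filter Function
open Literature.MathematicalPhysics.QuantumFieldTheory Literature.Analysis.OperatorTheory

namespace Summit.Ventures.YMGap.FlowData

/-! ### Configuration-level identities: flips, layers, commutation -/

section Config

variable {G : Type*} [Group G] {k L : ℕ} {z : G}

/-- The axial twist of the tree is the hyperplane flip at `x_μ = 0`:
`fluxTwist z ê_μ b = σ_0 b`. [cite: tHooft1979Flux] -/
theorem fluxTwist_single_eq_hyperplaneFlip (z : G) (μ : Fin k) (b : GaugeConfig k L G) :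
    fluxTwist z (Pi.single μ 1) b = fun e => (if e.2 = μ ∧ e.1 μ = 0 then z else 1) * b e := by
  funext e
  rw [fluxTwist_apply]
  unfold fluxTwistPrefactor
  congr 1
  by_cases h : e.2 = μ
  · simp only [h, Pi.single_eq_same, true_and]
  · have h0 : (Pi.single μ (1 : ZMod 2) : Fin k → ZMod 2) e.2 = 0 := by
      rw [Pi.single_apply, if_neg h]
    simp only [h0, zero_ne_one, false_and, if_false, h]

/-- Flip factors are `z` or `1`, hence central when `z` is. [folklore] -/
theorem flipFactor_mem_center (hz : z ∈ Subgroup.center G) (P : Prop) [Decidable P] :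
    (if P then z else (1 : G)) ∈ Subgroup.center G := by
  split_ifs; exacts [hz, Subgroup.one_mem _]

/-- A flip factor commutes with everything. [folklore] -/
theorem flipFactor_comm (hz : z ∈ Subgroup.center G) (P : Prop) [Decidable P] (g : G) :
    (if P then z else (1 : G)) * g = g * (if P then z else 1) :=
  (Subgroup.mem_center_iff.1 (flipFactor_mem_center hz P) g).symm
/-- Two flip factors can be swapped in front of anything. [folklore] -/
theorem flipFactor_left_comm (hz : z ∈ Subgroup.center G) (P Q : Prop) [Decidable P] [Decidable Q] (x : G) :
    (if P then z else (1 : G)) * ((if Q then z else 1) * x) = (if Q then z else 1) * ((if P then z else 1) * x) := by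
  rw [← mul_assoc, flipFactor_comm hz P, mul_assoc]

/-- A flip factor squares away (`z² = 1`). [folklore] -/
theorem flipFactor_cancel (hzz : z * z = 1) (P : Prop) [Decidable P] (x : G) :
    (if P then z else (1 : G)) * ((if P then z else 1) * x) = x := by
  rw [← mul_assoc]
  split_ifs <;> simp [hzz]

/-- **The layer gauge transformation is a product of two consecutive flips**: with `η_t(x) = z^{[x_μ = t]}`,
`b^{η_t} = σ_t (σ_{t−1} b)` (a `μ`-link from `x` picks up `η_t(x) η_t(x + ê_μ)⁻¹`, and `(x + ê_μ)_μ = t ↔ x_μ = t − 1`;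
links in other directions see the same layer value at both ends). [cite: tHooft1979Flux] -/
theorem gaugeTransform_layer (hz : z ∈ Subgroup.center G) (hzz : z * z = 1) (μ : Fin k) (t : ZMod L)
    (b : GaugeConfig k L G) :
    gaugeTransform (fun x : Site k L => if x μ = t then z else 1) b =
      fun e => (if e.2 = μ ∧ e.1 μ = t then z else 1) *
        ((if e.2 = μ ∧ e.1 μ = t - 1 then z else 1) * b e) := by
  have hzinv : z⁻¹ = z := inv_eq_of_mul_eq_one_right hzz
  funext e
  obtain ⟨x, i⟩ := e
  show (if x μ = t then z else 1) * b (x, i) * (if (Site.shift x i) μ = t then z else 1)⁻¹ =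
    (if i = μ ∧ x μ = t then z else 1) * ((if i = μ ∧ x μ = t - 1 then z else 1) * b (x, i))
  by_cases hi : i = μ
  · rw [hi]
    have hval : (Site.shift x μ) μ = x μ + 1 := by
      simp only [Site.shift, Pi.add_apply, Pi.single_eq_same]
    have hiff : (Site.shift x μ) μ = t ↔ x μ = t - 1 := by
      rw [hval]
      constructor
      · intro h; rw [← h, add_sub_cancel_right]
      · intro h; rw [h, sub_add_cancel]
    simp only [true_and]
    by_cases h1 : x μ = t - 1
    · rw [if_pos (hiff.2 h1), if_pos h1, hzinv, mul_assoc, Subgroup.mem_center_iff.1 hz (b (x, μ))]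
    · rw [if_neg (fun h => h1 (hiff.1 h)), if_neg h1, inv_one, mul_one, one_mul]
  · have hval : (Site.shift x i) μ = x μ := by
      simp only [Site.shift, Pi.add_apply, Pi.single_apply, if_neg (Ne.symm hi), add_zero]
    have hne : ¬(i = μ ∧ x μ = t) := fun h => hi h.1
    have hne' : ¬(i = μ ∧ x μ = t - 1) := fun h => hi h.1
    rw [if_neg hne, if_neg hne', one_mul, one_mul]
    by_cases h1 : x μ = t
    · have h1' : (Site.shift x i) μ = t := by rw [hval]; exact h1
      rw [if_pos h1, if_pos h1', hzinv, mul_assoc, Subgroup.mem_center_iff.1 hz (b (x, i)), ← mul_assoc, hzz,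
        one_mul]
    · have h1' : ¬(Site.shift x i) μ = t := by rw [hval]; exact h1
      rw [if_neg h1, if_neg h1', inv_one, mul_one, one_mul]

/-- `(σ_{t−1} b)^{η_t} = σ_t b`. [folklore] -/
theorem gaugeTransform_layer_hyperplaneFlip (hz : z ∈ Subgroup.center G) (hzz : z * z = 1) (μ : Fin k) (t : ZMod L)
    (b : GaugeConfig k L G) :
    gaugeTransform (fun x : Site k L => if x μ = t then z else 1)
        (fun e => (if e.2 = μ ∧ e.1 μ = t - 1 then z else 1) * b e) =
      fun e => (if e.2 = μ ∧ e.1 μ = t then z else 1) * b e := by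
  rw [gaugeTransform_layer hz hzz]
  funext e
  rw [flipFactor_cancel hzz]

/-- The layer gauge transformations are involutions on configurations. [folklore] -/
theorem gaugeTransform_layer_layer (hz : z ∈ Subgroup.center G) (hzz : z * z = 1) (μ : Fin k) (t : ZMod L)
    (b : GaugeConfig k L G) :
    gaugeTransform (fun x : Site k L => if x μ = t then z else 1)
        (gaugeTransform (fun x : Site k L => if x μ = t then z else 1) b) = b := by
  rw [gaugeTransform_layer hz hzz μ t b, gaugeTransform_layer hz hzz μ t]
  funext e
  rw [flipFactor_left_comm hz _ _ (b e), flipFactor_cancel hzz, flipFactor_cancel hzz]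

/-- The layer gauge transformations (any two directions, any two layers) commute with each other. [folklore] -/
theorem gaugeTransform_layer_comm (hz : z ∈ Subgroup.center G) (hzz : z * z = 1) (μ μ' : Fin k) (t t' : ZMod L)
    (b : GaugeConfig k L G) :
    gaugeTransform (fun x : Site k L => if x μ = t then z else 1)
        (gaugeTransform (fun x : Site k L => if x μ' = t' then z else 1) b) =
      gaugeTransform (fun x : Site k L => if x μ' = t' then z else 1)
        (gaugeTransform (fun x : Site k L => if x μ = t then z else 1) b) := by
  rw [gaugeTransform_layer hz hzz μ' t' b, gaugeTransform_layer hz hzz μ t, gaugeTransform_layer hz hzz μ t b,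
    gaugeTransform_layer hz hzz μ' t']
  funext e
  rw [flipFactor_left_comm hz _ _ ((if e.2 = μ' ∧ e.1 μ' = t' - 1 then z else 1) * b e),
    flipFactor_left_comm hz _ _ ((if e.2 = μ ∧ e.1 μ = t - 1 then z else 1) *
      ((if e.2 = μ' ∧ e.1 μ' = t' - 1 then z else 1) * b e)),
    flipFactor_left_comm hz _ _ (b e),
    flipFactor_left_comm hz _ _ ((if e.2 = μ ∧ e.1 μ = t - 1 then z else 1) * b e)]

/-- The layer gauge transformations commute with every hyperplane flip (any direction, any hyperplane). [folklore] -/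
theorem gaugeTransform_layer_hyperplaneFlip_comm (hz : z ∈ Subgroup.center G) (hzz : z * z = 1) (μ μ' : Fin k)
    (t s' : ZMod L) (b : GaugeConfig k L G) :
    gaugeTransform (fun x : Site k L => if x μ = t then z else 1)
        (fun e => (if e.2 = μ' ∧ e.1 μ' = s' then z else 1) * b e) =
      fun e => (if e.2 = μ' ∧ e.1 μ' = s' then z else 1) *
        gaugeTransform (fun x : Site k L => if x μ = t then z else 1) b e := by
  rw [gaugeTransform_layer hz hzz μ t, gaugeTransform_layer hz hzz μ t]
  funext e
  rw [flipFactor_left_comm hz _ _ (b e),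
    flipFactor_left_comm hz _ _ ((if e.2 = μ ∧ e.1 μ = t - 1 then z else 1) * b e)]

/-- **Spatial plaquettes are blind to every hyperplane flip**: `magSum (σ_s b) = magSum b` for all `s ∈ ℤ/L`
(`σ_0` is the tree's twist, `magSum_fluxTwist`; `σ_t = (σ_{t−1} ·)^{η_t}` and `magSum` is gauge invariant). [cite: tHooft1979Flux] -/
theorem magSum_hyperplaneFlip {n : ℕ} (ρ : G →* Matrix (Fin n) (Fin n) ℂ) [NeZero L] (hz : z ∈ Subgroup.center G)
    (hzz : z * z = 1) (μ : Fin k) (s : ZMod L) (b : GaugeConfig k L G) :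
    magSum (d := k) (L := L) ρ (fun e => (if e.2 = μ ∧ e.1 μ = s then z else 1) * b e) =
      magSum (d := k) (L := L) ρ b := by
  have key : ∀ j : ℕ, ∀ b : GaugeConfig k L G,
      magSum (d := k) (L := L) ρ (fun e => (if e.2 = μ ∧ e.1 μ = (j : ZMod L) then z else 1) * b e) =
        magSum (d := k) (L := L) ρ b := by
    intro j
    induction j with
    | zero =>
      intro b
      rw [Nat.cast_zero, ← fluxTwist_single_eq_hyperplaneFlip z μ b, magSum_fluxTwist ρ hz]
    | succ j ih =>
      intro b
      have htj : ((j + 1 : ℕ) : ZMod L) - 1 = (j : ZMod L) := by rw [Nat.cast_succ, add_sub_cancel_right]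
      rw [← gaugeTransform_layer_hyperplaneFlip hz hzz μ ((j + 1 : ℕ) : ZMod L) b, magSum_gaugeTransform, htj, ih]
  have hs : s = ((s.val : ℕ) : ZMod L) := (ZMod.natCast_zmod_val s).symm
  rw [hs]
  exact key s.val b

end Config

/-! ### Measure preservation of the flips -/

section Measure

variable {G : Type*} [Group G] [TopologicalSpace G] [IsTopologicalGroup G] [CompactSpace G]
  [MeasurableSpace G] [BorelSpace G] {k L : ℕ} [NeZero L]

/-- A hyperplane flip preserves the slice measure (left translation link by link). [folklore] -/
theorem measurePreserving_hyperplaneFlip' (z : G) (μ : Fin k) (s : ZMod L) :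
    MeasurePreserving (fun (b : GaugeConfig k L G) (e : Edge k L) => (if e.2 = μ ∧ e.1 μ = s then z else 1) * b e)
      (sliceMeasure G k L) (sliceMeasure G k L) :=
  measurePreserving_pi (f := fun (e : Edge k L) (x : G) => (if e.2 = μ ∧ e.1 μ = s then z else 1) * x)
    (fun _ : Edge k L => haarProbability G) (fun _ : Edge k L => haarProbability G)
    fun _ => measurePreserving_mul_left (haarProbability G) _

end Measure

/-! ### The symmetrisation inside the flux sector -/

section Symmetrization

variable {G : Type*} [Group G] [TopologicalSpace G] [IsTopologicalGroup G] [CompactSpace G]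
  [MeasurableSpace G] [BorelSpace G] [SecondCountableTopology G] {n : ℕ} (ρ : G →* Matrix (Fin n) (Fin n) ℂ)
  (J : ℝ) {k L : ℕ} [NeZero L]

/-- `χ_e(ê_μ) = −1` whenever `e_μ = 1`. [folklore] -/
theorem fluxSign_single_of_eq_one {e : Fin k → ZMod 2} {μ : Fin k} (hμ : e μ = 1) :
    fluxSign e (Pi.single μ 1 : Fin k → ZMod 2) = -1 := by
  unfold fluxSign
  rw [Finset.prod_eq_single μ]
  · simp only [hμ, Pi.single_eq_same, and_self, if_true]
  · intro ν _ hν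
    simp only [Pi.single_apply, if_neg hν, zero_ne_one, and_false, if_false]
  · intro h; exact absurd (Finset.mem_univ μ) h

omit [SecondCountableTopology G] in
/-- **A vector of the flux sector `e` is odd under the axial twist of every direction in the support of `e`**:
`(P_e ψ) ∘ σ_{μ,0} = −P_e ψ` a.e. whenever `e_μ = 1`. [cite: tHooft1979Flux] -/
theorem fluxProjection_odd_ae {z : G} (hzz : z * z = 1) (e : Fin k → ZMod 2) {μ : Fin k} (hμ : e μ = 1)
    (ψ : Lp ℝ 2 (sliceMeasure G k L)) :
    ∀ᵐ b ∂(sliceMeasure G k L),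
      (tubeFluxProjection z k L e ψ : GaugeConfig k L G → ℝ)
          (fun e' => (if e'.2 = μ ∧ e'.1 μ = 0 then z else 1) * b e') =
        -(tubeFluxProjection z k L e ψ : GaugeConfig k L G → ℝ) b := by
  set g := tubeFluxProjection z k L e ψ with hg
  have hop : fluxTwistOp k L z (Pi.single μ 1) g = -g := by
    have h := congrArg (fun A => A ψ) (fluxTwistOp_comp_tubeFluxProjection (k := k) (L := L) z hzz
      e (Pi.single μ 1))
    simp only [ContinuousLinearMap.comp_apply, fluxSign_single_of_eq_one hμ, neg_one_smul] at h
    exact h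
  have h1 := fluxTwistOp_ae_eq (L := L) z (Pi.single μ 1) g
  rw [hop] at h1
  filter_upwards [h1, Lp.coeFn_neg g] with b hb1 hb2
  rw [hb2, Pi.neg_apply, comp_apply, fluxTwist_single_eq_hyperplaneFlip] at hb1
  exact hb1.symm

/-- **One symmetrisation step.**  Given `g` odd under `σ_{μ',0}` for every direction `μ' ∈ D`, invariant under the layers
in `S`, with `T g = T g₀` and `‖g‖ ≤ ‖ψ‖`, the vector `g' = ½(g + G_{η_{μ,t}} g)` has the same properties and is moreover
`η_{μ,t}`-invariant. [cite: Luscher1977] -/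
theorem symmetrization_step (hρ : Continuous ρ) {z : G} (hz : z ∈ Subgroup.center G) (hzz : z * z = 1)
    (D : Finset (Fin k)) (μ : Fin k) (t : ZMod L) (S : Finset (Fin k × ZMod L)) (g₀ ψ g : Lp ℝ 2 (sliceMeasure G k L))
    (hodd : ∀ μ' ∈ D, ∀ᵐ b ∂(sliceMeasure G k L),
      (g : GaugeConfig k L G → ℝ) (fun e => (if e.2 = μ' ∧ e.1 μ' = 0 then z else 1) * b e) = -(g : GaugeConfig k L G → ℝ) b)
    (hinv : ∀ p ∈ S, ∀ᵐ b ∂(sliceMeasure G k L),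
      (g : GaugeConfig k L G → ℝ) (gaugeTransform (fun x : Site k L => if x p.1 = p.2 then z else 1) b) =
        (g : GaugeConfig k L G → ℝ) b)
    (hT : tubeTransferOperator ρ J k L g = tubeTransferOperator ρ J k L g₀) (hnorm : ‖g‖ ≤ ‖ψ‖) :
    ∃ g' : Lp ℝ 2 (sliceMeasure G k L),
      (∀ μ' ∈ D, ∀ᵐ b ∂(sliceMeasure G k L),
        (g' : GaugeConfig k L G → ℝ) (fun e => (if e.2 = μ' ∧ e.1 μ' = 0 then z else 1) * b e) =
          -(g' : GaugeConfig k L G → ℝ) b) ∧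
      (∀ p ∈ insert (μ, t) S, ∀ᵐ b ∂(sliceMeasure G k L),
        (g' : GaugeConfig k L G → ℝ) (gaugeTransform (fun x : Site k L => if x p.1 = p.2 then z else 1) b) =
          (g' : GaugeConfig k L G → ℝ) b) ∧
      tubeTransferOperator ρ J k L g' = tubeTransferOperator ρ J k L g₀ ∧ ‖g'‖ ≤ ‖ψ‖ := by
  set η : Site k L → G := fun x => if x μ = t then z else 1 with hη
  have hmp : MeasurePreserving (gaugeTransform η : GaugeConfig k L G → GaugeConfig k L G)
      (sliceMeasure G k L) (sliceMeasure G k L) :=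
    WilsonGauge.measurePreserving_gaugeTransform η
  set Gt : Lp ℝ 2 (sliceMeasure G k L) →L[ℝ] Lp ℝ 2 (sliceMeasure G k L) :=
    (Lp.compMeasurePreservingₗᵢ ℝ (gaugeTransform η : GaugeConfig k L G → GaugeConfig k L G) hmp).toContinuousLinearMap
    with hGt
  set g' : Lp ℝ 2 (sliceMeasure G k L) := (1 / 2 : ℝ) • (g + Gt g) with hg'
  have hGt_ae : ((Gt g : Lp ℝ 2 (sliceMeasure G k L)) : GaugeConfig k L G → ℝ) =ᵐ[sliceMeasure G k L]
      (g : GaugeConfig k L G → ℝ) ∘ gaugeTransform η := Lp.coeFn_compMeasurePreserving g hmp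
  -- the a.e. formula for `g'`
  have hg'_ae : ∀ᵐ b ∂(sliceMeasure G k L), (g' : GaugeConfig k L G → ℝ) b =
      (1 / 2 : ℝ) * ((g : GaugeConfig k L G → ℝ) b + (g : GaugeConfig k L G → ℝ) (gaugeTransform η b)) := by
    filter_upwards [Lp.coeFn_smul (1 / 2 : ℝ) (g + Gt g), Lp.coeFn_add g (Gt g), hGt_ae] with b hb1 hb2 hb3
    rw [hg', hb1, Pi.smul_apply, hb2, Pi.add_apply, hb3, comp_apply, smul_eq_mul]
  refine ⟨g', ?_, ?_, ?_, ?_⟩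
  · -- oddness under `σ_{μ',0}` for `μ' ∈ D`
    intro μ' hμ'
    have hflip_mp : MeasurePreserving
        (fun (b : GaugeConfig k L G) (e : Edge k L) => (if e.2 = μ' ∧ e.1 μ' = 0 then z else 1) * b e)
        (sliceMeasure G k L) (sliceMeasure G k L) :=
      measurePreserving_hyperplaneFlip' z μ' 0
    have h1 := hflip_mp.quasiMeasurePreserving.ae hg'_ae
    have h2 := hmp.quasiMeasurePreserving.ae (hodd μ' hμ')
    filter_upwards [hg'_ae, h1, hodd μ' hμ', h2] with b hb hb1 hb2 hb3
    rw [hb1, hb, gaugeTransform_layer_hyperplaneFlip_comm hz hzz μ μ' t 0 b, hb2, hb3]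
    ring
  · -- invariance under the layers in `insert (μ, t) S`
    intro p hp
    rcases Finset.mem_insert.1 hp with hpt | hpS
    · rw [hpt]
      have h1 := hmp.quasiMeasurePreserving.ae hg'_ae
      filter_upwards [hg'_ae, h1] with b hb hb1
      rw [hb1, hb, gaugeTransform_layer_layer hz hzz μ t b]
      ring
    · set η' : Site k L → G := fun x => if x p.1 = p.2 then z else 1 with hη'
      have hmp' : MeasurePreserving (gaugeTransform η' : GaugeConfig k L G → GaugeConfig k L G)
          (sliceMeasure G k L) (sliceMeasure G k L) :=
        WilsonGauge.measurePreserving_gaugeTransform η'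
      have h1 := hmp'.quasiMeasurePreserving.ae hg'_ae
      have h2 := hmp.quasiMeasurePreserving.ae (hinv p hpS)
      filter_upwards [hg'_ae, h1, hinv p hpS, h2] with b hb hb1 hb2 hb3
      rw [hb1, hb, hb2, gaugeTransform_layer_comm hz hzz μ p.1 t p.2 b, hb3]
  · -- `T g' = T g₀`
    have hTG : tubeTransferOperator ρ J k L (Gt g) = tubeTransferOperator ρ J k L g := by
      have h := congrArg (fun A => A g) (tubeTransferOperator_comp_gaugeOp (k := k) (L := L) ρ J hρ η)
      simpa only [ContinuousLinearMap.comp_apply] using h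
    rw [hg', map_smul, map_add, hTG, hT, ← two_smul ℝ, smul_smul]
    norm_num
  · -- `‖g'‖ ≤ ‖ψ‖`
    have hGn : ‖Gt g‖ = ‖g‖ := Lp.norm_compMeasurePreserving g hmp
    calc ‖g'‖ = (1 / 2 : ℝ) * ‖g + Gt g‖ := by
          rw [hg', norm_smul, Real.norm_of_nonneg (by norm_num : (0 : ℝ) ≤ 1 / 2)]
      _ ≤ (1 / 2 : ℝ) * (‖g‖ + ‖Gt g‖) := mul_le_mul_of_nonneg_left (norm_add_le _ _) (by norm_num)
      _ = ‖g‖ := by rw [hGn]; ring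
      _ ≤ ‖ψ‖ := hnorm

/-- **Symmetrisation over any finite set of layers**, keeping the oddness under `σ_{μ',0}` for every `μ'` with
`e_{μ'} = 1`. [folklore] -/
theorem exists_symmetrized (hρ : Continuous ρ) {z : G} (hz : z ∈ Subgroup.center G) (hzz : z * z = 1)
    (e : Fin k → ZMod 2) (ψ : Lp ℝ 2 (sliceMeasure G k L)) (S : Finset (Fin k × ZMod L)) :
    ∃ g : Lp ℝ 2 (sliceMeasure G k L),
      (∀ μ' ∈ Finset.univ.filter (fun μ' : Fin k => e μ' = 1), ∀ᵐ b ∂(sliceMeasure G k L),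
        (g : GaugeConfig k L G → ℝ) (fun e' => (if e'.2 = μ' ∧ e'.1 μ' = 0 then z else 1) * b e') =
          -(g : GaugeConfig k L G → ℝ) b) ∧
      (∀ p ∈ S, ∀ᵐ b ∂(sliceMeasure G k L),
        (g : GaugeConfig k L G → ℝ) (gaugeTransform (fun x : Site k L => if x p.1 = p.2 then z else 1) b) =
          (g : GaugeConfig k L G → ℝ) b) ∧
      tubeTransferOperator ρ J k L g = tubeTransferOperator ρ J k L (tubeFluxProjection z k L e ψ) ∧
      ‖g‖ ≤ ‖ψ‖ := by
  classical
  induction S using Finset.induction_on with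
  | empty =>
    refine ⟨tubeFluxProjection z k L e ψ, fun μ' hμ' => ?_, fun p hp => absurd hp (Finset.notMem_empty p), rfl, ?_⟩
    · exact fluxProjection_odd_ae hzz e (Finset.mem_filter.1 hμ').2 ψ
    · calc ‖tubeFluxProjection z k L e ψ‖ ≤ ‖tubeFluxProjection z k L e‖ * ‖ψ‖ := ContinuousLinearMap.le_opNorm _ _
        _ ≤ 1 * ‖ψ‖ := mul_le_mul_of_nonneg_right (norm_tubeFluxProjection_le_one z k L _) (norm_nonneg _)
        _ = ‖ψ‖ := one_mul _
  | insert p S _ ih =>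
    obtain ⟨g, h1, h2, h3, h4⟩ := ih
    exact symmetrization_step ρ J hρ hz hzz _ p.1 p.2 S _ ψ g h1 h2 h3 h4

/-- **INSIDE A FLUX SECTOR, `T` ONLY SEES JOINTLY ODD FUNCTIONS.**  For every flux `e ∈ ℤ₂^k` and `ψ ∈ L²(slice)` there
is `g ∈ L²(slice)` with `T g = T (P_e ψ)`, `‖g‖ ≤ ‖ψ‖`, and `g ∘ σ_{μ,s} = −g` a.e. for EVERY direction `μ` with
`e_μ = 1` and EVERY hyperplane `x_μ = s`, `s ∈ ℤ/L` (continuous `ρ`, central involution `z`).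
[cite: tHooft1979Flux] [cite: Luscher1977] -/
theorem exists_jointlyOdd_of_fluxProjection (hρ : Continuous ρ) {z : G} (hz : z ∈ Subgroup.center G)
    (hzz : z * z = 1) (e : Fin k → ZMod 2) (ψ : Lp ℝ 2 (sliceMeasure G k L)) :
    ∃ g : Lp ℝ 2 (sliceMeasure G k L),
      tubeTransferOperator ρ J k L g = tubeTransferOperator ρ J k L (tubeFluxProjection z k L e ψ) ∧
      ‖g‖ ≤ ‖ψ‖ ∧
      ∀ μ : Fin k, e μ = 1 → ∀ s : ZMod L, ∀ᵐ b ∂(sliceMeasure G k L),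
        (g : GaugeConfig k L G → ℝ) (fun e' => (if e'.2 = μ ∧ e'.1 μ = s then z else 1) * b e') =
          -(g : GaugeConfig k L G → ℝ) b := by
  classical
  obtain ⟨g, hodd, hinv, hT, hnorm⟩ := exists_symmetrized ρ J hρ hz hzz e ψ Finset.univ
  refine ⟨g, hT, hnorm, fun μ hμ => ?_⟩
  have hodd0 := hodd μ (Finset.mem_filter.2 ⟨Finset.mem_univ μ, hμ⟩)
  -- induction along the layers: `σ_{μ,t}` from `σ_{μ,t-1}` and `η_{μ,t}`
  have key : ∀ j : ℕ, ∀ᵐ b ∂(sliceMeasure G k L),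
      (g : GaugeConfig k L G → ℝ) (fun e' => (if e'.2 = μ ∧ e'.1 μ = (j : ZMod L) then z else 1) * b e') =
        -(g : GaugeConfig k L G → ℝ) b := by
    intro j
    induction j with
    | zero => simpa only [Nat.cast_zero] using hodd0
    | succ j ih =>
      set t : ZMod L := ((j + 1 : ℕ) : ZMod L) with ht
      have htj : t - 1 = (j : ZMod L) := by rw [ht, Nat.cast_succ, add_sub_cancel_right]
      have hmpσ : MeasurePreserving
          (fun (b : GaugeConfig k L G) (e' : Edge k L) => (if e'.2 = μ ∧ e'.1 μ = t - 1 then z else 1) * b e')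
          (sliceMeasure G k L) (sliceMeasure G k L) :=
        measurePreserving_hyperplaneFlip' z μ (t - 1)
      have h1 := hmpσ.quasiMeasurePreserving.ae (hinv (μ, t) (Finset.mem_univ _))
      filter_upwards [h1, ih] with b hb1 hb2
      rw [gaugeTransform_layer_hyperplaneFlip hz hzz μ t b] at hb1
      rw [hb1, htj]
      exact hb2
  intro s
  have hs : s = ((s.val : ℕ) : ZMod L) := (ZMod.natCast_zmod_val s).symm
  rw [hs]
  exact key s.val

/-- The axial case: inside the sector `ê_μ`, `T` only sees functions odd under every hyperplane flip along `μ`.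
[cite: tHooft1979Flux] -/
theorem exists_jointlyOdd_of_fluxProjection_single (hρ : Continuous ρ) {z : G} (hz : z ∈ Subgroup.center G)
    (hzz : z * z = 1) (μ : Fin k) (ψ : Lp ℝ 2 (sliceMeasure G k L)) :
    ∃ g : Lp ℝ 2 (sliceMeasure G k L),
      tubeTransferOperator ρ J k L g = tubeTransferOperator ρ J k L (tubeFluxProjection z k L (Pi.single μ 1) ψ) ∧
      ‖g‖ ≤ ‖ψ‖ ∧
      ∀ s : ZMod L, ∀ᵐ b ∂(sliceMeasure G k L),
        (g : GaugeConfig k L G → ℝ) (fun e' => (if e'.2 = μ ∧ e'.1 μ = s then z else 1) * b e') =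
          -(g : GaugeConfig k L G → ℝ) b := by
  obtain ⟨g, hT, hnorm, hodd⟩ := exists_jointlyOdd_of_fluxProjection ρ J hρ hz hzz (Pi.single μ 1) ψ
  exact ⟨g, hT, hnorm, hodd μ (by simp)⟩

end Symmetrization

end Summit.Ventures.YMGap.FlowData
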